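/-
Copyright: H21 programme, solo seat `solo-RiemannHypothesis-informed` (session 4).
-/
import Summits.RiemannHypothesis.RiemannHypothesis.Theorems.SoloInformedDoubleLog

/-!
# The explicit double-logarithmic window (solo-informed, T17)

The two analytic side conditions of `weilGroundEnergy_neg_of_local_bumpDipole` (T16) are met
by an explicit displacement: for a fixed bump `ψ ≥ 0` in `[−1, 1]` with `Φ(η) > 0` and a fixed
offset `0 < η < ½` there is `c₀ = c₀(ψ, η) ≥ 0` such that for every `|γ₀| ≥ 1` and every
`c ≥ c₀ + log log(|γ₀| + 2) / (2η)`: a zero `½ + η + iγ₀` together with local RH of radius `R`,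
`R² ≥ e^{c+1}`, forces `ε(c+1) < 0` (`weilGroundEnergy_neg_of_local_doubleLog`).

In words: GRANTED local RH in a poly-logarithmic neighbourhood of the height, an off-line zero
of fixed offset `η` is visible to Weil positivity from the DOUBLY logarithmic window
`a = 1 + c₀(ψ,η) + (2η)⁻¹ log log(|γ₀| + 2)`. The single-log window `a ≍ log|γ₀|` of the
hypothesis-free analysis is the price of the possible far off-line zeros, not of `γ₀`'s own pair.
-/

open MeasureTheory Complex Set Filter Topology Literature.NumberTheory.LFunctions
open scoped ContDiff

namespace Summit.RiemannHypothesis.RiemannHypothesis.Theorems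

variable {ψ : ℝ → ℝ}

/-- **The double-log window (T17).** See the module docstring; `c₀` is
`max (η⁻¹ log(2Φ(−η)/Φ(η) + 1)) ((2η)⁻¹ log(4K/(η⁴Φ(η)²) + 1))` with `K = K(ψ)` from T16. -/
theorem weilGroundEnergy_neg_of_local_doubleLog (hψ : ContDiff ℝ ∞ ψ)
    (hsupp : tsupport ψ ⊆ Icc (-1) 1) (hψ0 : ∀ s, 0 ≤ ψ s) {η : ℝ} (hη : 0 < η)
    (hη2 : η < 1 / 2) (hΦ : 0 < bumpLaplace ψ η) :
    ∃ c₀ : ℝ, 0 ≤ c₀ ∧ ∀ (γ₀ c R : ℝ), 1 ≤ |γ₀| →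
      c₀ + Real.log (Real.log (|γ₀| + 2)) / (2 * η) ≤ c → 1 ≤ R → Real.exp (c + 1) ≤ R ^ 2 →
      riemannZeta (1 / 2 + η + γ₀ * I) = 0 →
      (∀ ρ : ℂ, riemannZeta ρ = 0 → 0 ≤ ρ.re → ρ.re ≤ 1 → |ρ.im - γ₀| < R → ρ.re ≠ 1 / 2 →
          ρ = 1 / 2 + η + γ₀ * I ∨ ρ = 1 / 2 - η + γ₀ * I) →
      weilGroundEnergy (c + 1) < 0 := by
  obtain ⟨K, hK, hT⟩ := weilGroundEnergy_neg_of_local_bumpDipole hψ hsupp hψ0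
  set Φ : ℝ := bumpLaplace ψ η with hΦ_def
  set Φm : ℝ := bumpLaplace ψ (-η) with hΦm_def
  have hΦm : 0 ≤ Φm := bumpLaplace_nonneg hψ0 (-η)
  set c₁ : ℝ := Real.log (2 * Φm / Φ + 1) / η with hc₁_def
  set c₂ : ℝ := Real.log (4 * K / (η ^ 4 * Φ ^ 2) + 1) / (2 * η) with hc₂_def
  have hq1 : 0 < 2 * Φm / Φ + 1 := by positivity
  have hq2 : 0 < 4 * K / (η ^ 4 * Φ ^ 2) + 1 := by positivity
  have hc₁ : 0 ≤ c₁ :=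
    div_nonneg (Real.log_nonneg (le_add_of_nonneg_left (by positivity))) hη.le
  refine ⟨max c₁ c₂, hc₁.trans (le_max_left _ _), fun γ₀ c R hγ hc hR hRa hζ hloc ↦ ?_⟩
  have hγ0 : γ₀ ≠ 0 := by intro h; rw [h, abs_zero] at hγ; linarith
  have hL : 1 < Real.log (|γ₀| + 2) := by
    rw [Real.lt_log_iff_exp_lt (by positivity)]
    linarith [Real.exp_one_lt_d9]
  have hL0 : 0 < Real.log (|γ₀| + 2) := by linarith
  have hlogL : 0 < Real.log (Real.log (|γ₀| + 2)) := Real.log_pos hL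
  have h2η : 0 < 2 * η := by linarith
  have hcc₁ : c₁ ≤ c := by
    have : 0 ≤ Real.log (Real.log (|γ₀| + 2)) / (2 * η) := by positivity
    linarith [le_max_left c₁ c₂]
  have hcc₂ : c₂ + Real.log (Real.log (|γ₀| + 2)) / (2 * η) ≤ c := by
    linarith [le_max_right c₁ c₂]
  have hc0 : 0 ≤ c := hc₁.trans hcc₁
  -- (i) the reflected mass is dominated: `2Φ(−η) < e^{ηc} Φ(η)`
  have e1 : Real.exp (η * c₁) = 2 * Φm / Φ + 1 := by
    rw [show η * c₁ = Real.log (2 * Φm / Φ + 1) by rw [hc₁_def]; field_simp, Real.exp_log hq1]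
  have i1 : 2 * Φm / Φ + 1 ≤ Real.exp (η * c) :=
    e1 ▸ Real.exp_le_exp.mpr (mul_le_mul_of_nonneg_left hcc₁ hη.le)
  have i1' : 2 * Φm + Φ ≤ Real.exp (η * c) * Φ := by
    have := mul_le_mul_of_nonneg_right i1 hΦ.le
    rwa [add_mul, one_mul, div_mul_cancel₀ _ hΦ.ne'] at this
  have hdom : Φm ≤ Real.exp (η * c) * Φ := by linarith
  -- (ii) the height condition: `(4K/(η⁴Φ²) + 1)·log(|γ₀|+2) ≤ e^{2ηc}`
  have e2 : Real.exp (2 * η * c₂) = 4 * K / (η ^ 4 * Φ ^ 2) + 1 := by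
    rw [show 2 * η * c₂ = Real.log (4 * K / (η ^ 4 * Φ ^ 2) + 1) by rw [hc₂_def]; field_simp,
      Real.exp_log hq2]
  have i2 : (4 * K / (η ^ 4 * Φ ^ 2) + 1) * Real.log (|γ₀| + 2) ≤ Real.exp (2 * η * c) := by
    have step : 2 * η * c₂ + Real.log (Real.log (|γ₀| + 2)) ≤ 2 * η * c := by
      have hne : η ≠ 0 := hη.ne'
      have e3 : 2 * η * (c₂ + Real.log (Real.log (|γ₀| + 2)) / (2 * η)) =
          2 * η * c₂ + Real.log (Real.log (|γ₀| + 2)) := by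
        field_simp
      have := mul_le_mul_of_nonneg_left hcc₂ h2η.le
      linarith [e3]
    calc (4 * K / (η ^ 4 * Φ ^ 2) + 1) * Real.log (|γ₀| + 2)
        = Real.exp (2 * η * c₂ + Real.log (Real.log (|γ₀| + 2))) := by
          rw [Real.exp_add, e2, Real.exp_log hL0]
      _ ≤ Real.exp (2 * η * c) := Real.exp_le_exp.mpr step
  have hpos : 0 < η ^ 4 * Φ ^ 2 := by positivity
  have i2' : 4 * K * Real.log (|γ₀| + 2) < η ^ 4 * Φ ^ 2 * Real.exp (2 * η * c) := by
    have h := mul_le_mul_of_nonneg_left i2 hpos.le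
    have expand : η ^ 4 * Φ ^ 2 * ((4 * K / (η ^ 4 * Φ ^ 2) + 1) * Real.log (|γ₀| + 2)) =
        4 * K * Real.log (|γ₀| + 2) + η ^ 4 * Φ ^ 2 * Real.log (|γ₀| + 2) := by
      field_simp
    rw [expand] at h
    have : 0 < η ^ 4 * Φ ^ 2 * Real.log (|γ₀| + 2) := by positivity
    linarith
  -- the gain
  set g : ℝ := Real.exp (η * c) * Φ - Φm with hg_def
  have hg : Real.exp (η * c) * Φ / 2 ≤ g := by rw [hg_def]; linarith
  have hg0 : 0 ≤ Real.exp (η * c) * Φ / 2 := by positivity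
  have hg2 : Real.exp (2 * η * c) * Φ ^ 2 / 4 ≤ g ^ 2 := by
    have h := pow_le_pow_left₀ hg0 hg 2
    have e : (Real.exp (η * c) * Φ / 2) ^ 2 = Real.exp (2 * η * c) * Φ ^ 2 / 4 := by
      rw [div_pow, mul_pow, sq (Real.exp _), ← Real.exp_add]; ring_nf
    rwa [e] at h
  have hwin : K * Real.log (|γ₀| + 2) < η ^ 4 * g ^ 2 := by
    have := mul_le_mul_of_nonneg_left hg2 (by positivity : (0 : ℝ) ≤ η ^ 4)
    linarith
  exact hT η γ₀ c R hη hη2 hγ0 hc0 hR hRa hζ hloc hdom hwin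

end Summit.RiemannHypothesis.RiemannHypothesis.Theorems
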